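import Literature.Probability.LatticeModels.MedialInterfaceProofs

/-!
# `CoherentMorera` (route `CardyComplexCone`, stmt-CriticalPhenomena-11388): the exact lattice frame —
# Kirchhoff (DC12 Prop. 4) corner fields, potentials, `ℤ₄` modes, characters

Negative-side support for the crux `CoherentMorera` (cdisprove unit, generation 3, refuter
`refuter-cdisprove-stmt-CriticalPhenomena-11388-g3-0`; work file
`Summits/CriticalPhenomena/CardyFormulaZ2/Cruxes/CoherentMorera/Disproof.lean`), part 1 of 2
(part 2, `CharacterSelectionLoadBearing.lean`, builds the tightness model on this frame).

The crux is `EdgeCoherence → EdgePrecompact → (WeakHolomorphyFamilies ∧ PrecompactFamilies)` for the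
spin-`1/3` parafermionic observables of critical bond percolation on `ℤ²`; its intended proof
("Morera with sublattices") rests on the Duminil-Copin 2012 Prop. 4 vertex relation of the corner
observable (certified with chirality `χ = +i` by exact enumeration, kit j005379 / j006260 /
j005085), quarter-turn covariance, and the corner→vertex trace identity.  This file is the exact
lattice algebra of that frame, over the corner coding `(v, faceAt v k)` of `MedialInterfaceProofs`:

* §B `KirchhoffAt` — Prop. 4 in flux form on corner fields `E : Site 2 → Fin 4 → ℂ`; compass forms
  `E(NW) − E(SE) = i (E(NE) − E(SW))` at horizontal / vertical medial vertices
  (`kirchhoffAt_zero_iff`, `kirchhoffAt_one_iff`); co-gradient fields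
  `E(v,k) = i^{-k}(H_F(faceAt v k) − H_S v)` satisfy it identically (`kirchhoffAt_potentialField`).
* §C the `ℤ₄`-Fourier modes `A₀ … A₃` (spin `1/3, 4/3, 7/3, 10/3` site observables), Fourier
  inversion, and the potential dictionary `A₀ = ∂_d H_F`, `A₂ = ∂̄_d H_F`, `A₁ =` mixed second
  difference (so the leading-order content of Kirchhoff at one vertex is `A₁ = o(δ^{1/3})`),
  `A₃ = Σ_faces H_F − 4 H_S` (free).
* §D `character_single_mode`, `character_const_of_A0_ne_zero`: a `ℤ₄`-character class vector (the
  only universal vectors compatible with quarter-turn covariance) charges exactly one mode; if its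
  spin-`1/3` mode is non-zero it is the trivial character.  Consequence for the crux: every
  "wrong character" case of the planner's why-might-fail closes (`χ₀` via the staggered identity,
  `χ₂, χ₃` trivially since then `A₀ = o(δ^{1/3})`, `χ₁` only for a degenerate observable).
-/

noncomputable section

open Complex
open Literature.Probability.LatticeModels

namespace Summit.CriticalPhenomena.CardyFormulaZ2.Theorems.CoherentMorera.Negative

/-! ## §B Corner fields on `ℤ²`, the Kirchhoff (DC12 Prop. 4, `χ = +i`) relation, potentials

A corner field assigns a complex number to every corner `(v, faceAt v k)` (`k : Fin 4`
counter-clockwise, `faceAt v 0 = v`; class `k` ↔ offset `f − v = −cornerOff k ∈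
{0, −e₀, −e₀−e₁, −e₁}`, the four classes of the crux, `faceAt_sub`).  The corner `(v,k)` is the
medial edge from the midpoint of the lattice edge `s(v, v + cornerUnit k)` to that of
`s(v, v + cornerUnit (k+1))` (`cornerSource_faceAt`, `cornerTarget_faceAt`); its travel direction is
`e^{3πi/4}·i^k` (NW, SW, SE, NE for `k = 0, 1, 2, 3`). -/

/-- The weights `i^k` (travel directions with the common factor `e^{3πi/4}` dropped). [folklore] -/
def wt : Fin 4 → ℂ
  | 0 => 1
  | 1 => I
  | 2 => -1
  | 3 => -I

/-- The inverse weights `i^{-k}`. [folklore] -/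
def wtInv : Fin 4 → ℂ
  | 0 => 1
  | 1 => -I
  | 2 => -1
  | 3 => I

/-- `i^0 = 1`. [folklore] -/
@[simp] theorem wt_zero : wt 0 = 1 := rfl
/-- `i^1 = i`. [folklore] -/
@[simp] theorem wt_one : wt 1 = I := rfl
/-- `i^2 = -1`. [folklore] -/
@[simp] theorem wt_two : wt 2 = -1 := rfl
/-- `i^3 = -i`. [folklore] -/
@[simp] theorem wt_three : wt 3 = -I := rfl
/-- `i^0 = 1`. [folklore] -/
@[simp] theorem wtInv_zero : wtInv 0 = 1 := rfl
/-- `i^{-1} = -i`. [folklore] -/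
@[simp] theorem wtInv_one : wtInv 1 = -I := rfl
/-- `i^{-2} = -1`. [folklore] -/
@[simp] theorem wtInv_two : wtInv 2 = -1 := rfl
/-- `i^{-3} = i`. [folklore] -/
@[simp] theorem wtInv_three : wtInv 3 = I := rfl

/-- `i^k · i^{-k} = 1`. [folklore] -/
theorem wt_mul_wtInv (k : Fin 4) : wt k * wtInv k = 1 := by
  fin_cases k
  · simp
  · simp
  · simp
  · simp

/-- **Kirchhoff's law at a medial vertex** — the lattice edge `e = s(v, v + cornerUnit k)`: the
direction-weighted sum over the two corners LEAVING `e`, `(v, k)` and `(v + e_k, k+2)`, equals that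
over the two corners ARRIVING at `e`, `(v, k+3)` and `(v + e_k, k+1)`.  This is the flux form of the
Duminil-Copin 2012 Prop. 4 / DCS 2012 Prop. 8.6 relation with chirality `χ = +i`
(`kirchhoffAt_zero_iff`, `kirchhoffAt_one_iff`), the form in which gen-1/gen-2/ideator-3 certified it
for the percolation corner observable ("divergence-freeness of the flow `E·t`"). [folklore] -/
def KirchhoffAt (E : Site 2 → Fin 4 → ℂ) (v : Site 2) (k : Fin 4) : Prop :=
  wt k * E v k + wt (k + 2) * E (v + cornerUnit k) (k + 2) =
    wt (k + 3) * E v (k + 3) + wt (k + 1) * E (v + cornerUnit k) (k + 1)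

/-- **Dictionary, horizontal medial vertex** `s(x, x + e₀)`: in the clockwise compass labels of the
barrier file (`NW = (x, x)` = class 0 at `x`, `NE = (x+e₀, x)` = class 1 at `x + e₀`,
`SE = (x+e₀, x−e₁)` = class 2 at `x + e₀`, `SW = (x, x−e₁)` = class 3 at `x`) Kirchhoff reads
`E(NW) − E(SE) = i (E(NE) − E(SW))`, i.e. `HalfCRRelationAt I`. [folklore] -/
theorem kirchhoffAt_zero_iff (E : Site 2 → Fin 4 → ℂ) (x : Site 2) :
    KirchhoffAt E x 0 ↔
      E x 0 - E (x + cornerUnit 0) 2 = I * (E (x + cornerUnit 0) 1 - E x 3) := by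
  simp only [KirchhoffAt, show (0 : Fin 4) + 1 = 1 from rfl, show (0 : Fin 4) + 2 = 2 from rfl,
    show (0 : Fin 4) + 3 = 3 from rfl, wt_zero, wt_one, wt_two, wt_three]
  constructor <;> intro h <;> linear_combination h

/-- **Dictionary, vertical medial vertex** `s(x, x + e₁)`: with `NW = (x+e₁, x−e₀)` = class 2 at
`x + e₁`, `NE = (x+e₁, x)` = class 3 at `x + e₁`, `SE = (x, x)` = class 0 at `x`, `SW = (x, x−e₀)` =
class 1 at `x`, Kirchhoff again reads `E(NW) − E(SE) = i (E(NE) − E(SW))` (same chirality at both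
orientations, as certified by the enumerations). [folklore] -/
theorem kirchhoffAt_one_iff (E : Site 2 → Fin 4 → ℂ) (x : Site 2) :
    KirchhoffAt E x 1 ↔
      E (x + cornerUnit 1) 2 - E x 0 = I * (E (x + cornerUnit 1) 3 - E x 1) := by
  simp only [KirchhoffAt, show (1 : Fin 4) + 1 = 2 from rfl, show (1 : Fin 4) + 2 = 3 from rfl,
    show (1 : Fin 4) + 3 = 0 from rfl, wt_zero, wt_one, wt_two, wt_three]
  constructor <;> intro h <;> linear_combination h

/-- **Potential (co-gradient) corner fields**: `E(v,k) = i^{-k}·(H_F(faceAt v k) − H_S(v))` for a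
face potential `H_F` and a site potential `H_S`.  (On a simply connected region these are ALL the
Kirchhoff fields: a divergence-free flow on the planar medial graph is the co-gradient of a
function on its faces, which are the sites and the faces of `ℤ²`; cf. the local kernel element
`faceKernel` of the barrier file = the potential field of the indicator of one face.) [folklore] -/
def potentialField (HS HF : Site 2 → ℂ) : Site 2 → Fin 4 → ℂ :=
  fun v k => wtInv k * (HF (faceAt v k) - HS v)

/-- **Potential fields satisfy Kirchhoff at every medial vertex** (both orientations, every site),
exactly. [folklore] -/
theorem kirchhoffAt_potentialField (HS HF : Site 2 → ℂ) (v : Site 2) (k : Fin 4) :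
    KirchhoffAt (potentialField HS HF) v k := by
  unfold KirchhoffAt potentialField
  rw [faceAt_add_unit_add_two, faceAt_add_unit_succ]
  have h0 := wt_mul_wtInv k
  have h1 := wt_mul_wtInv (k + 1)
  have h2 := wt_mul_wtInv (k + 2)
  have h3 := wt_mul_wtInv (k + 3)
  linear_combination (HF (faceAt v k) - HS v) * h0 +
    (HF (faceAt v (k + 3)) - HS (v + cornerUnit k)) * h2 -
    (HF (faceAt v (k + 3)) - HS v) * h3 - (HF (faceAt v k) - HS (v + cornerUnit k)) * h1

/-! ## §C The `ℤ₄`-Fourier modes of a corner field at a site -/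

/-- Mode `A₀ = Σ_k E(v,k)`: the spin-`1/3` SITE observable (sum of the four corner values); by the
trace identity the vertex observable of a lattice edge is `(2cos(π/12))⁻¹` times the sum of one
corner of each class at its two endpoints. [folklore] -/
def A0 (E : Site 2 → Fin 4 → ℂ) (v : Site 2) : ℂ := E v 0 + E v 1 + E v 2 + E v 3

/-- Mode `A₁ = Σ_k i^{-k} E(v,k)` (spin `4/3`). [folklore] -/
def A1 (E : Site 2 → Fin 4 → ℂ) (v : Site 2) : ℂ := E v 0 - I * E v 1 - E v 2 + I * E v 3

/-- Mode `A₂ = Σ_k (−1)^k E(v,k)` (spin `7/3`; the STAGGERED combination). [folklore] -/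
def A2 (E : Site 2 → Fin 4 → ℂ) (v : Site 2) : ℂ := E v 0 - E v 1 + E v 2 - E v 3

/-- Mode `A₃ = Σ_k i^{k} E(v,k)` (spin `10/3 ≡ −2/3`). [folklore] -/
def A3 (E : Site 2 → Fin 4 → ℂ) (v : Site 2) : ℂ := E v 0 + I * E v 1 - E v 2 - I * E v 3

/-- Fourier inversion, class 0: `4 E(v,0) = A₀ + A₁ + A₂ + A₃`. [folklore] -/
theorem four_mul_corner_zero (E : Site 2 → Fin 4 → ℂ) (v : Site 2) :
    4 * E v 0 = A0 E v + A1 E v + A2 E v + A3 E v := by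
  simp only [A0, A1, A2, A3]; ring

/-- Fourier inversion, class 1: `4 E(v,1) = A₀ + i A₁ − A₂ − i A₃`. [folklore] -/
theorem four_mul_corner_one (E : Site 2 → Fin 4 → ℂ) (v : Site 2) :
    4 * E v 1 = A0 E v + I * A1 E v - A2 E v - I * A3 E v := by
  simp only [A0, A1, A2, A3]; linear_combination (2 * (E v 1 - E v 3)) * Complex.I_sq

/-- Fourier inversion, class 2: `4 E(v,2) = A₀ − A₁ + A₂ − A₃`. [folklore] -/
theorem four_mul_corner_two (E : Site 2 → Fin 4 → ℂ) (v : Site 2) :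
    4 * E v 2 = A0 E v - A1 E v + A2 E v - A3 E v := by
  simp only [A0, A1, A2, A3]; ring

/-- Fourier inversion, class 3: `4 E(v,3) = A₀ − i A₁ − A₂ + i A₃`. [folklore] -/
theorem four_mul_corner_three (E : Site 2 → Fin 4 → ℂ) (v : Site 2) :
    4 * E v 3 = A0 E v - I * A1 E v - A2 E v + I * A3 E v := by
  simp only [A0, A1, A2, A3]; linear_combination (2 * (E v 3 - E v 1)) * Complex.I_sq

/-- `A₀` of a potential field is the discrete `∂`-derivative of the FACE potential around `v`
(weights `i^{-k}` on the four faces counter-clockwise); the site potential drops out. [folklore] -/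
theorem A0_potentialField (HS HF : Site 2 → ℂ) (v : Site 2) :
    A0 (potentialField HS HF) v =
      HF (faceAt v 0) - I * HF (faceAt v 1) - HF (faceAt v 2) + I * HF (faceAt v 3) := by
  simp only [A0, potentialField, wtInv_zero, wtInv_one, wtInv_two, wtInv_three]; ring

/-- `A₁` of a potential field is the mixed second difference of the face potential (hence
`O(δ²·‖H_F‖_{C²})`: the leading-order content of Kirchhoff at one vertex is `A₁ = o(δ^{1/3})`). [folklore] -/
theorem A1_potentialField (HS HF : Site 2 → ℂ) (v : Site 2) :
    A1 (potentialField HS HF) v =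
      HF (faceAt v 0) - HF (faceAt v 1) + HF (faceAt v 2) - HF (faceAt v 3) := by
  simp only [A1, potentialField, wtInv_zero, wtInv_one, wtInv_two, wtInv_three]
  linear_combination (HF (faceAt v 1) + HF (faceAt v 3) - 2 * HS v) * Complex.I_sq

/-- `A₂` of a potential field is the discrete `∂̄`-derivative of the face potential. [folklore] -/
theorem A2_potentialField (HS HF : Site 2 → ℂ) (v : Site 2) :
    A2 (potentialField HS HF) v =
      HF (faceAt v 0) + I * HF (faceAt v 1) - HF (faceAt v 2) - I * HF (faceAt v 3) := by
  simp only [A2, potentialField, wtInv_zero, wtInv_one, wtInv_two, wtInv_three]; ring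

/-- `A₃` of a potential field is `Σ_faces H_F − 4 H_S`: the only mode that sees the site potential,
unconstrained by Kirchhoff. [folklore] -/
theorem A3_potentialField (HS HF : Site 2 → ℂ) (v : Site 2) :
    A3 (potentialField HS HF) v =
      HF (faceAt v 0) + HF (faceAt v 1) + HF (faceAt v 2) + HF (faceAt v 3) - 4 * HS v := by
  simp only [A3, potentialField, wtInv_zero, wtInv_one, wtInv_two, wtInv_three]
  linear_combination (2 * HS v - HF (faceAt v 1) - HF (faceAt v 3)) * Complex.I_sq

/-! ## §D Characters: exactly one live mode -/

/-- `u : Fin 4 → ℂ` is a `ℤ₄`-character vector: `u(k+1) = λ u(k)` with `λ⁴ = 1` (the shape forced on a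
universal class vector by quarter-turn covariance, card `z4-trace-character-collapse`). [folklore] -/
def IsZ4Character (u : Fin 4 → ℂ) : Prop := ∃ l : ℂ, l ^ 4 = 1 ∧ ∀ k, u (k + 1) = l * u k

/-- The modes of a vector `u` are the modes of the constant corner field `(v,k) ↦ u k`. [folklore] -/
def vecField (u : Fin 4 → ℂ) : Site 2 → Fin 4 → ℂ := fun _ k => u k

/-- **A character charges exactly one mode**: all pairwise products of its four modes vanish. [folklore] -/
theorem character_single_mode {u : Fin 4 → ℂ} (h : IsZ4Character u) :
    A0 (vecField u) 0 * A1 (vecField u) 0 = 0 ∧ A0 (vecField u) 0 * A2 (vecField u) 0 = 0 ∧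
    A0 (vecField u) 0 * A3 (vecField u) 0 = 0 ∧ A1 (vecField u) 0 * A2 (vecField u) 0 = 0 ∧
    A1 (vecField u) 0 * A3 (vecField u) 0 = 0 ∧ A2 (vecField u) 0 * A3 (vecField u) 0 = 0 := by
  obtain ⟨l, hl, hu⟩ := h
  have h1 : u 1 = l * u 0 := hu 0
  have h2 : u 2 = l * u 1 := hu 1
  have h3 : u 3 = l * u 2 := hu 2
  simp only [A0, A1, A2, A3, vecField]
  rw [h3, h2, h1]
  refine ⟨?_, ?_, ?_, ?_, ?_, ?_⟩
  · linear_combination (-(u 0) ^ 2 * (1 + l) * (1 - I * l)) * hl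
  · linear_combination (-(u 0) ^ 2 * (1 + l ^ 2)) * hl
  · linear_combination (-(u 0) ^ 2 * (1 + l) * (1 + I * l)) * hl
  · linear_combination (-(u 0) ^ 2 * (1 - l) * (1 - I * l)) * hl
  · linear_combination (-(u 0) ^ 2 * (1 - l ^ 2)) * hl +
      (-(u 0) ^ 2 * l ^ 2 * (1 - l ^ 2) ^ 2) * Complex.I_sq
  · linear_combination (-(u 0) ^ 2 * (1 - l) * (1 + I * l)) * hl

/-- **The conformal character.** A character whose spin-`1/3` mode is non-zero is the TRIVIAL
character (all four corner classes equal at leading order) — the only case in which the first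
clause of `Conclusion` is not trivially true. [folklore] -/
theorem character_const_of_A0_ne_zero {u : Fin 4 → ℂ} (h : IsZ4Character u)
    (h0 : A0 (vecField u) 0 ≠ 0) : ∀ k, u k = u 0 := by
  obtain ⟨l, hl, hu⟩ := h
  have h1 : u 1 = l * u 0 := hu 0
  have h2 : u 2 = l * u 1 := hu 1
  have h3 : u 3 = l * u 2 := hu 2
  have hA : A0 (vecField u) 0 = u 0 * (1 + l + l ^ 2 + l ^ 3) := by
    simp only [A0, vecField]; rw [h3, h2, h1]; ring
  have hl1 : l = 1 := by
    by_contra hne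
    apply h0
    rw [hA]
    have hfac : (l - 1) * (1 + l + l ^ 2 + l ^ 3) = 0 := by linear_combination hl
    rcases mul_eq_zero.1 hfac with h | h
    · exact absurd (sub_eq_zero.1 h) hne
    · rw [h, mul_zero]
  subst hl1
  have e1 : u 1 = u 0 := by rw [h1, one_mul]
  have e2 : u 2 = u 0 := by rw [h2, one_mul, e1]
  have e3 : u 3 = u 0 := by rw [h3, one_mul, e2]
  intro k
  fin_cases k
  · rfl
  · exact e1
  · exact e2
  · exact e3

/-- Dictionary with the crux's class vector `u : Site 2 → ℂ` (indexed by the offset `f − v`): the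
offset of the class-`k` corner is `−cornerOff k`. [folklore] -/
theorem faceAt_sub (v : Site 2) (k : Fin 4) : faceAt v k - v = -cornerOff k := by
  simp [faceAt]

end Summit.CriticalPhenomena.CardyFormulaZ2.Theorems.CoherentMorera.Negative

end
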